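import Summits.Ventures.YMGap.RobustBall.LangevinPoincare
import Summits.Ventures.YMGap.Thresholds.SharpPoincare
import HarnessLib

/-!
# Robust ball (Y2) — the Langevin Poincaré inequality for EVERY INFINITE-VOLUME LIMIT STATE in the GRADIENT form `∫ Γ(f,f) dμ` (Shen–Zhu–Zhu (4.13)),
# on the Kantorovich–Rubinstein window

HONEST FRAMING: venture file of the cell `pub-ymgap` (QuantumFields programme), track ROBUST-BALL, seat rb-p2 (g13); companion of `LangevinPoincare.lean`
(torus, uniformly in the volume) and `LangevinPoincareCells.lean` (limit states, LIPSCHITZ form).  LATTICE statements at STRONG COUPLING, `SU(2)`, `d = 4`,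
Wilson action; nothing about `β → ∞`, the continuum or Clay.
* `Gam_comp_restrict` — functoriality of the carré du champ under restriction of the links: for the coordinate restriction `prj : (E' → M_N) → (Λ → M_N)`,
  `prj Q = Q ∘ ι` along an INJECTIVE `ι : Λ → E'`, and smooth `f`, `Γ(f ∘ prj)(Q) = Γ(f)(prj Q)` (blocks of links outside the image vanish).
* ★★★ `variance_le_integral_Gam_of_mem_infiniteVolumeLimitPoints_of_torus` — from a volume-uniform torus inequality `Var_{μ_L}(g) ≤ C ∫ Γ(g,g) dμ_L` (all
  tori of side `≥ 2`, all smooth `g`) to `Var_μ(F) ≤ C ∫ Γ(f,f)((U_e)_{e∈Λ}) dμ(U)` for every infinite-volume (tight) limit `μ` and every smooth cylinder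
  function `F = f((U_e)_{e∈Λ})` (both sides are limits of torus expectations of continuous cylinder functions).
* ★★★ `su2_limit_variance_le_integral_Gam` — `SU(2)`, `0 ≤ β_W < 2/9`, every `μ ∈ infiniteVolumeLimitPoints χ₂ (β_W/2)`:
  `Var_μ(F) ≤ ((1 − 9β_W/2)(1 − 3β_W))⁻¹ ∫ Γ(f,f) dμ` — the variance clause of SZZ Cor. 4.5 (4.13) in its printed (Dirichlet-form) shape, on a window
  `16/9` times the Bakry–Émery one.  0 sorry, 0 definitions.  Everything here is proved. [folklore]
-/

noncomputable section

open scoped Matrix ComplexConjugate BigOperators Matrix.Norms.Frobenius ContDiff Topology ProbabilityTheory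
open Matrix Complex Finset MeasureTheory Filter ProbabilityTheory Function Real
open Literature.MathematicalPhysics.QuantumFieldTheory
open Literature.MathematicalPhysics.QuantumLattice (fundamentalRep continuous_fundamentalRep
  torusEdge torusLift toTorusObservable infiniteVolumeLimitPoints IsInfiniteVolumeLimitAlong IsCylinder)
open Literature.MathematicalPhysics.QuantumFieldTheory.SUNBakryEmery (SUN FrameIdx frame)
open Summit.Ventures.YMGap.LatticeBakryEmery

namespace Summit.Ventures.YMGap.RobustBall.LangevinPoincare

universe u v

/-! ### Functoriality of `Γ` under an injective restriction of the links -/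

section Restrict

variable {ι : Type u} {ι' : Type v} [Fintype ι] [DecidableEq ι] [Fintype ι'] [DecidableEq ι'] {N : ℕ}

/-- **`Γ(f ∘ prj) = Γ(f) ∘ prj`** for the restriction `prj Q = Q ∘ j` along an injective `j : ι → ι'` (the blocks of the links outside the image of `j` vanish,
the block of `j e` is the block of `e`). [folklore] -/
theorem Gam_comp_restrict {j : ι → ι'} (hj : Function.Injective j) {f : Cfg ι N → ℝ} (hf : ContDiff ℝ ∞ f) (Q : Cfg ι' N) :
    Gam (fun P : Cfg ι' N => f (fun e => P (j e))) (fun P : Cfg ι' N => f (fun e => P (j e))) Q = Gam f f (fun e => Q (j e)) := by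
  -- the restriction as a continuous linear map
  set prj : Cfg ι' N →L[ℝ] Cfg ι N := ContinuousLinearMap.pi fun e => ContinuousLinearMap.proj (R := ℝ) (φ := fun _ : ι' => Matrix (Fin N) (Fin N) ℂ) (j e)
    with hprj
  have hprjapp : ∀ P : Cfg ι' N, prj P = fun e => P (j e) := fun P => rfl
  have hfun : (fun P : Cfg ι' N => f (fun e => P (j e))) = f ∘ prj := by funext P; rfl
  -- link derivatives of `f ∘ prj`
  have hD : ∀ (e' : ι') (Y : Matrix (Fin N) (Fin N) ℂ), algD (lk e' Y) (f ∘ prj) Q = fderiv ℝ f (prj Q) (prj (Q * lk e' Y)) := by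
    intro e' Y
    have h := ((hf.differentiable (by simp) (prj Q)).hasFDerivAt.comp Q prj.hasFDerivAt).fderiv
    rw [algD_apply, h, ContinuousLinearMap.comp_apply]
    rfl
  have hprjlk : ∀ (e' : ι') (Y : Matrix (Fin N) (Fin N) ℂ), prj (Q * lk e' Y) = fun e => if j e = e' then Q e' * Y else 0 := by
    intro e' Y
    rw [mul_lk, hprjapp]
    funext e
    by_cases h : j e = e'
    · rw [if_pos h, h]; simp [lk]
    · rw [if_neg h]; simp [lk, h]
  -- block of an image link
  have himg : ∀ (e : ι) (Y : Matrix (Fin N) (Fin N) ℂ), algD (lk (j e) Y) (f ∘ prj) Q = algD (lk e Y) f (prj Q) := by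
    intro e Y
    rw [hD, hprjlk, algD_apply, mul_lk]
    congr 1
    funext e₁
    by_cases h : e₁ = e
    · subst h; simp [lk, hprjapp]
    · have h' : j e₁ ≠ j e := fun hh => h (hj hh)
      simp [lk, h, h']
  -- block of a non-image link vanishes
  have hout : ∀ (e' : ι'), (∀ e, j e ≠ e') → ∀ Y : Matrix (Fin N) (Fin N) ℂ, algD (lk e' Y) (f ∘ prj) Q = 0 := by
    intro e' he' Y
    rw [hD, hprjlk]
    have : (fun e => if j e = e' then Q e' * Y else 0) = (0 : Cfg ι N) := by
      funext e; rw [if_neg (he' e)]; rfl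
    rw [this, map_zero]
  rw [hfun, Gam_eq_sum_blocks, Gam_eq_sum_blocks]
  -- regroup the sum over `ι'` along the image of `j`
  have hsplit : ∀ e' : ι', ∑ α : FrameIdx N, algD (lk e' (frame α)) (f ∘ prj) Q ^ 2 =
      ∑ e : ι, if j e = e' then ∑ α : FrameIdx N, algD (lk e (frame α)) f (prj Q) ^ 2 else 0 := by
    intro e'
    by_cases hex : ∃ e, j e = e'
    · obtain ⟨e, rfl⟩ := hex
      rw [Finset.sum_eq_single e (fun b _ hb => if_neg (fun h => hb (hj h))) (fun h => absurd (mem_univ _) h), if_pos rfl]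
      exact Finset.sum_congr rfl fun α _ => by rw [himg]
    · push Not at hex
      rw [Finset.sum_eq_zero fun e _ => if_neg (hex e)]
      exact Finset.sum_eq_zero fun α _ => by rw [hout e' (fun e => hex e), zero_pow two_ne_zero]
  simp_rw [hsplit]
  rw [Finset.sum_comm]
  refine Finset.sum_congr rfl fun e _ => ?_
  rw [Finset.sum_ite_eq univ (j e)]
  simp [hprjapp]

end Restrict

/-! ### Passage to every infinite-volume (tight) limit, gradient form -/

section Limits

variable {N : ℕ}

/-- ★★★ **From a volume-uniform torus Poincaré inequality in GRADIENT form to every infinite-volume limit**: if on every torus of side `≥ 2` every smooth `g`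
of the link matrices satisfies `Var_{μ_{β,L}}(g) ≤ C ∫ Γ(g,g) dμ_{β,L}`, then every tight limit `μ` of the torus states at tree coupling `β` satisfies
`Var_μ(F) ≤ C ∫ Γ(f,f)((U_e)_{e∈Λ}) dμ(U)` for every smooth cylinder function `F = f((U_e)_{e∈Λ})` (both sides are limits of torus expectations of continuous
cylinder observables; on the torus `Λ_{L}` the cylinder function is `f ∘ π_L` and `Γ(f ∘ π_L) = Γ(f) ∘ π_L` once `Λ` embeds, `Gam_comp_restrict`). [folklore] -/
theorem variance_le_integral_Gam_of_mem_infiniteVolumeLimitPoints_of_torus {β C : ℝ}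
    (htorus : ∀ (L : ℕ) [NeZero L], 1 < L → ∀ {g : Cfg (Edge 4 L) N → ℝ}, ContDiff ℝ ∞ g →
      Var[fun U => g (emb U); wilsonMeasure (d := 4) (L := L) (fundamentalRep (Fin N)) β] ≤
        C * ∫ U, Gam g g (emb U) ∂(wilsonMeasure (d := 4) (L := L) (fundamentalRep (Fin N)) β))
    {μ : Measure (Literature.MathematicalPhysics.QuantumLattice.LGConfig 4 (Matrix.specialUnitaryGroup (Fin N) ℂ))}
    (hμ : μ ∈ infiniteVolumeLimitPoints (d := 4) (fundamentalRep (Fin N)) β)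
    (Λ : Finset (ZdEdge 4)) {f : (↥Λ → Matrix (Fin N) (Fin N) ℂ) → ℝ} (hf : ContDiff ℝ ∞ f) :
    Var[matrixCylinder Λ f; μ] ≤ C * ∫ U, Gam f f (fun e : ↥Λ => (U e : Matrix (Fin N) (Fin N) ℂ)) ∂μ := by
  obtain ⟨Ls, hLs, hprob, hlim⟩ := hμ
  haveI := hprob
  set F : Literature.MathematicalPhysics.QuantumLattice.LGConfig 4 (Matrix.specialUnitaryGroup (Fin N) ℂ) → ℝ := matrixCylinder Λ f with hF
  set G : Literature.MathematicalPhysics.QuantumLattice.LGConfig 4 (Matrix.specialUnitaryGroup (Fin N) ℂ) → ℝ :=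
    fun U => Gam f f (fun e : ↥Λ => (U e : Matrix (Fin N) (Fin N) ℂ)) with hG
  -- `F`, `F²`, `G` are bounded continuous cylinder functions
  have hcfgc : Continuous fun (U : Literature.MathematicalPhysics.QuantumLattice.LGConfig 4 (Matrix.specialUnitaryGroup (Fin N) ℂ)) (e : ↥Λ) =>
      (U e : Matrix (Fin N) (Fin N) ℂ) := continuous_pi fun e => continuous_subtype_val.comp (continuous_apply _)
  have hFcyl : IsCylinder F Λ := isCylinder_matrixCylinder Λ f
  have hFc : Continuous F := hf.continuous.comp hcfgc
  have hGcyl : IsCylinder G Λ := fun U V hUV => by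
    show Gam f f _ = Gam f f _
    congr 1
    funext e
    rw [hUV e e.2]
  have hGc : Continuous G := (contDiff_Gam hf hf).continuous.comp hcfgc
  obtain ⟨C₀, hC0⟩ : ∃ C₀, ∀ U, |F U| ≤ C₀ := by
    obtain ⟨C₀, hb⟩ := (isCompact_univ (X := Literature.MathematicalPhysics.QuantumLattice.LGConfig 4
      (Matrix.specialUnitaryGroup (Fin N) ℂ))).exists_bound_of_continuousOn hFc.continuousOn
    exact ⟨C₀, fun U => by simpa [Real.norm_eq_abs] using hb U (Set.mem_univ _)⟩
  obtain ⟨CG, hCG⟩ : ∃ CG, ∀ U, |G U| ≤ CG := by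
    obtain ⟨C₀, hb⟩ := (isCompact_univ (X := Literature.MathematicalPhysics.QuantumLattice.LGConfig 4
      (Matrix.specialUnitaryGroup (Fin N) ℂ))).exists_bound_of_continuousOn hGc.continuousOn
    exact ⟨C₀, fun U => by simpa [Real.norm_eq_abs] using hb U (Set.mem_univ _)⟩
  have hF2cyl : IsCylinder (fun U => F U ^ 2) Λ := fun U V hUV => by
    show F U ^ 2 = F V ^ 2
    rw [hFcyl hUV]
  have ht1 := hlim F Λ hFcyl hFc ⟨C₀, hC0⟩
  have ht2 := hlim (fun U => F U ^ 2) Λ hF2cyl (hFc.pow 2) ⟨C₀ ^ 2, fun U => by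
    rw [abs_pow]; exact pow_le_pow_left₀ (abs_nonneg _) (hC0 U) 2⟩
  have ht3 := hlim G Λ hGcyl hGc ⟨CG, hCG⟩
  -- the variance of `μ` as a limit of torus variances; `C ∫ G dμ` as a limit of torus expectations
  have hmem : MemLp F 2 μ := MemLp.of_bound hFc.aestronglyMeasurable C₀ (ae_of_all _ fun U => by rw [Real.norm_eq_abs]; exact hC0 U)
  have hvarμ : Var[F; μ] = (∫ U, F U ^ 2 ∂μ) - (∫ U, F U ∂μ) ^ 2 := by rw [variance_eq_sub hmem]; rfl
  have htv : Tendsto (fun k => wilsonExpectation (L := Ls k + 1) (fundamentalRep (Fin N)) β (toTorusObservable (Ls k + 1) fun U => F U ^ 2) -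
      wilsonExpectation (L := Ls k + 1) (fundamentalRep (Fin N)) β (toTorusObservable (Ls k + 1) F) ^ 2) atTop (𝓝 (Var[F; μ])) := by
    rw [hvarμ]; exact ht2.sub (ht1.pow 2)
  have htG : Tendsto (fun k => C * wilsonExpectation (L := Ls k + 1) (fundamentalRep (Fin N)) β (toTorusObservable (Ls k + 1) G)) atTop
      (𝓝 (C * ∫ U, G U ∂μ)) := ht3.const_mul C
  -- eventually: torus variance ≤ C · torus expectation of `G`
  have h2 : Tendsto (fun k => Ls k + 1) atTop atTop := tendsto_atTop_mono (fun k => Nat.le_succ (Ls k)) hLs.tendsto_atTop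
  have hev : ∀ᶠ k : ℕ in atTop,
      wilsonExpectation (L := Ls k + 1) (fundamentalRep (Fin N)) β (toTorusObservable (Ls k + 1) fun U => F U ^ 2) -
        wilsonExpectation (L := Ls k + 1) (fundamentalRep (Fin N)) β (toTorusObservable (Ls k + 1) F) ^ 2
        ≤ C * wilsonExpectation (L := Ls k + 1) (fundamentalRep (Fin N)) β (toTorusObservable (Ls k + 1) G) := by
    have hinj : ∀ᶠ k : ℕ in atTop, Set.InjOn (torusEdge (d := 4) (Ls k + 1)) ↑Λ :=
      h2.eventually (LatticeBakryEmery.eventually_injOn_torusEdge (d := 4) Λ)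
    have hge : ∀ᶠ k : ℕ in atTop, 1 < Ls k + 1 := h2.eventually (eventually_gt_atTop 1)
    refine (hinj.and hge).mono fun k hk => ?_
    obtain ⟨hk, hk1⟩ := hk
    set L' : ℕ := Ls k + 1 with hL'
    -- the cylinder function on the torus as a function of ALL torus links: `g = f ∘ π`
    set j : ↥Λ → Edge 4 L' := fun e => torusEdge L' (e : ZdEdge 4) with hj
    have hjinj : Function.Injective j := fun e₁ e₂ h => Subtype.ext (hk e₁.2 e₂.2 h)
    set g : Cfg (Edge 4 L') N → ℝ := fun Q => f fun e : ↥Λ => Q (j e) with hg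
    have hgc : ContDiff ℝ ∞ g := hf.comp (contDiff_pi.2 fun e => contDiff_apply ℝ _ (j e))
    have hT := htorus L' hk1 hgc
    -- identify both sides with Wilson expectations of `F², F` and `G`
    haveI := isProbabilityMeasure_wilsonMeasure (d := 4) (L := L') (fundamentalRep (Fin N)) (continuous_fundamentalRep (n := Fin N)) β
    have hgF : (fun U : PSU (Edge 4 L') N => g (emb U)) = toTorusObservable L' F := by funext U; rfl
    have hgc' : Continuous fun U : PSU (Edge 4 L') N => g (emb U) := continuous_restrict hgc
    have hmemk : MemLp (fun U : PSU (Edge 4 L') N => g (emb U)) 2 (wilsonMeasure (d := 4) (L := L') (fundamentalRep (Fin N)) β) :=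
      MemLp.of_bound hgc'.aestronglyMeasurable C₀ (ae_of_all _ fun U => by rw [Real.norm_eq_abs]; exact hC0 (torusLift L' U))
    have hvk : Var[fun U : PSU (Edge 4 L') N => g (emb U); wilsonMeasure (d := 4) (L := L') (fundamentalRep (Fin N)) β] =
        wilsonExpectation (L := L') (fundamentalRep (Fin N)) β (toTorusObservable L' fun U => F U ^ 2) -
          wilsonExpectation (L := L') (fundamentalRep (Fin N)) β (toTorusObservable L' F) ^ 2 := by
      rw [variance_eq_sub hmemk, hgF]; rfl
    have hGam : ∀ U : PSU (Edge 4 L') N, Gam g g (emb U) = toTorusObservable L' G U := fun U => by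
      have h := Gam_comp_restrict hjinj hf (emb U)
      simp only [hg] at h ⊢
      rw [h]
      rfl
    have hGk : ∫ U, Gam g g (emb U) ∂(wilsonMeasure (d := 4) (L := L') (fundamentalRep (Fin N)) β) =
        wilsonExpectation (L := L') (fundamentalRep (Fin N)) β (toTorusObservable L' G) := by
      simp_rw [hGam]; rfl
    rw [← hvk, ← hGk]
    exact hT
  exact le_of_tendsto_of_tendsto htv htG hev

/-- ★★★ **`SU(2)`, `d = 4`, HYPOTHESIS-FREE: the Langevin Poincaré inequality for EVERY INFINITE-VOLUME LIMIT STATE in gradient form on `0 ≤ β_W < 2/9`**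
(the variance clause of Shen–Zhu–Zhu Cor. 4.5 (4.13) in its printed shape; tree coupling `β_W/2`): for every tight limit `μ` of the `SU(2)` torus Wilson states and
every smooth cylinder function `F = f((U_e)_{e∈Λ})`, `Var_μ(F) ≤ ((1 − 9β_W/2)(1 − 3β_W))⁻¹ ∫ Γ(f,f)((U_e)_{e∈Λ}) dμ(U)` (the venture's Bakry–Émery window for
this clause is `β_W < 1/8`, Shen–Zhu–Zhu's `1/12`). [folklore] -/
theorem su2_limit_variance_le_integral_Gam {βW : ℝ} (h0 : 0 ≤ βW) (h : βW < 2 / 9)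
    {μ : Measure (Literature.MathematicalPhysics.QuantumLattice.LGConfig 4 (Matrix.specialUnitaryGroup (Fin 2) ℂ))}
    (hμ : μ ∈ infiniteVolumeLimitPoints (d := 4) (fundamentalRep (Fin 2)) (βW / 2))
    (Λ : Finset (ZdEdge 4)) {f : (↥Λ → Matrix (Fin 2) (Fin 2) ℂ) → ℝ} (hf : ContDiff ℝ ∞ f) :
    Var[matrixCylinder Λ f; μ] ≤ ((1 - 9 * βW / 2) * (1 - 3 * βW))⁻¹ * ∫ U, Gam f f (fun e : ↥Λ => (U e : Matrix (Fin 2) (Fin 2) ℂ)) ∂μ :=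
  variance_le_integral_Gam_of_mem_infiniteVolumeLimitPoints_of_torus
    (fun L _ hL => fun hg => su2_variance_le_integral_Gam (L := L) h0 h hL hg) hμ Λ hf

end Limits

end Summit.Ventures.YMGap.RobustBall.LangevinPoincare

end
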